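import Mathlib
import HarnessLib
import Summits.HubbardSuperconductivity.HubbardSuperconductivity.Theses.NodalWardXY
import Literature.MathematicalPhysics.QuantumLattice.DWaveSource
import Literature.MathematicalPhysics.QuantumLattice.BdGBondHamiltonianTorus
import Literature.Probability.LatticeModels.LatticeGraph

/-!
# Sketch — crux-ideate stmt-HubbardSuperconductivity-1268 (NodalWardXY.NodalReduction), ideator 2, round 1

First lemmas of three crux idea cards (statements only; they need not be proved here, they must
elaborate):

* card `convex-stiffness-gaussian-domination`: `SchurStiffnessStability` (provable now) and the
  J-RELATIVE engine `PerturbedXYOrderRel` the nodal reduction actually consumes, with the trivial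
  direction `PerturbedXYOrderRel → PerturbedXYOrder` (the filed engine is its ε-absolute corollary).
* card `vortex-core-budget-doping-knob`: `VisonPairCostUniform` (the Δ₀-uniform form of the vison
  premise that the weak-coupling limit consumes) and its free-fermion anchor `VisonPairCostFree`
  (two Aharonov–Bohm half-flux tubes in the lattice Fermi sea), typed over the landed `bdgTorus`.
* card `zero-field-plateau-kt-bridge`: `KTBridge` (plateau pair LRO of the tracial grand-canonical
  torus ground state at h = 0 ⇒ `dWaveOrderParameter ≥ √(a/2)`, the proved Koma–Tasaki /
  Kaplan–Horsch–von der Linden direction; provable now, M-size) and the re-aimed crux conclusion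
  `ZeroFieldTarget`, with the composition `ZeroFieldTarget → KTBridge-conclusion`.
-/

namespace Summit.HubbardSuperconductivity.HubbardSuperconductivity.Cruxes.NodalReduction.Ideator2

open scoped BigOperators Matrix
open Filter MeasureTheory
open Literature.Probability.LatticeModels Literature.MathematicalPhysics.QuantumLattice
open Summit.HubbardSuperconductivity.HubbardSuperconductivity.Theses.NodalWardXY

/-! ## Card A — convexity at large stiffness -/

/-- Schur-test stability of the dressed spin-wave quadratic form: a real two-current kernel bounded
RELATIVE to the stiffness, `|K(b,b')| ≤ ε J (1+dist)⁻⁴`, perturbs `J Σ_b v_b²` by at most the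
relative amount `ε C₄`, where `C₄` bounds the row sums `Σ_{b'} (1+dist(b,b'))⁻⁴` (uniformly in `L`
on `(ℤ/Lℤ)³ × Fin 3`). This is the input of a Brascamp–Lieb (log-concavity) infrared bound on the
vortex-free sector. Provable now (|K v v'| ≤ |K|(v²+v'²)/2 and row sums). -/
def SchurStiffnessStability : Prop :=
  ∀ (L : ℕ) [NeZero L] (J ε C₄ : ℝ), 0 < J → 0 ≤ ε →
    (∀ b : TorusSite 3 L × Fin 3,
        ∑ b' : TorusSite 3 L × Fin 3, 1 / (1 + ((torusGraph 3 L).dist b.1 b'.1 : ℝ)) ^ 4 ≤ C₄) →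
    ∀ K : (TorusSite 3 L × Fin 3) → (TorusSite 3 L × Fin 3) → ℝ,
      (∀ b b', |K b b'| ≤ ε * J / (1 + ((torusGraph 3 L).dist b.1 b'.1 : ℝ)) ^ 4) →
      ∀ v : (TorusSite 3 L × Fin 3) → ℝ,
        |∑ b, ∑ b', K b b' * v b * v b'| ≤ ε * C₄ * (J * ∑ b, v b ^ 2)

/-- The J-RELATIVE engine (same vocabulary as `NodalWardXY.PerturbedXYOrder`, one change: the kernel
bound is `ε·J·(1+dist)⁻⁴` instead of `ε·(1+dist)⁻⁴`). This is the statement the nodal reduction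
consumes: at weak coupling the stiffness per coherence cell is `J ≍ E_F/Δ → ∞` and every
fermion-induced term scales with `J`. -/
def PerturbedXYOrderRel : Prop :=
  ∃ J₀ ε a : ℝ, 0 < ε ∧ 0 < a ∧ ∀ J : ℝ, J₀ ≤ J → ∀ (L : ℕ) [NeZero L], 2 ≤ L →
    ∀ K : (TorusSite 3 L × Fin 3) → (TorusSite 3 L × Fin 3) → ℂ,
      (∀ b b', ‖K b b'‖ ≤ ε * J / (1 + ((torusGraph 3 L).dist b.1 b'.1 : ℝ)) ^ 4) →
      let cube : Set (TorusSite 3 L → ℝ) := Set.pi Set.univ (fun _ => Set.Icc (0:ℝ) (2 * Real.pi))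
      let cur : (TorusSite 3 L × Fin 3) → (TorusSite 3 L → ℝ) → ℝ :=
        fun b θ => Real.sin (θ (b.1 + Pi.single b.2 1) - θ b.1)
      let wJ : (TorusSite 3 L → ℝ) → ℂ := fun θ =>
        ((Real.exp (J * ∑ b : TorusSite 3 L × Fin 3, Real.cos (θ (b.1 + Pi.single b.2 1) - θ b.1)) : ℝ) : ℂ)
      let W : (TorusSite 3 L → ℝ) → ℂ := fun θ => ∑ b, ∑ b', K b b' * (cur b θ : ℂ) * (cur b' θ : ℂ)
      let Z : ℂ := MeasureTheory.integral (MeasureTheory.volume.restrict cube)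
        (fun θ => wJ θ * Complex.exp (W θ))
      Z ≠ 0 ∧ a ≤ ((∑ x : TorusSite 3 L, ∑ y : TorusSite 3 L,
        MeasureTheory.integral (MeasureTheory.volume.restrict cube)
          (fun θ => (Real.cos (θ x - θ y) : ℂ) * (wJ θ * Complex.exp (W θ)))) / Z / ((L : ℂ) ^ 6)).re

/-- The filed engine is the ε-absolute corollary of the relative one (take `J₀ ⊔ 1`). -/
theorem perturbedXYOrder_of_rel (h : PerturbedXYOrderRel) : PerturbedXYOrder := by
  obtain ⟨J₀, ε, a, hε, ha, H⟩ := h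
  refine ⟨max J₀ 1, ε, a, hε, ha, fun J hJ L _ hL K hK => ?_⟩
  have hJ₀ : J₀ ≤ J := le_trans (le_max_left _ _) hJ
  have hJ1 : (1 : ℝ) ≤ J := le_trans (le_max_right _ _) hJ
  refine H J hJ₀ L hL K fun b b' => (hK b b').trans ?_
  have hden : 0 < (1 + ((torusGraph 3 L).dist b.1 b'.1 : ℝ)) ^ 4 := by positivity
  rw [div_le_div_iff_of_pos_right hden]
  nlinarith [hε.le]

/-! ## Card B — the Δ₀-uniform vison budget -/

/-- Bond data of the route's vison pair: sign `-1` exactly on the `R` vertical bonds leaving the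
sites `(a, 0)`, `0 ≤ a < R`. -/
def visonSign (L : ℕ) (R : ℕ) (x : TorusSite 2 L) (i : Fin 2) : ℝ :=
  if i = 1 ∧ x 1 = 0 ∧ (x 0).val < R then -1 else 1

/-- The vison-pair d-wave BdG Hamiltonian over the landed `bdgTorus`: hopping `-s_R`, bond pairing
`s_R Δ₀ gᵢ`, `g = (+1, -1)`, chemical potential `μ`. -/
noncomputable def visonBdG (L : ℕ) [NeZero L] (μ Δ₀ : ℝ) (R : ℕ) :
    Matrix (Finset (Orb (FermionTorus 2 L))) (Finset (Orb (FermionTorus 2 L))) ℂ :=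
  bdgTorus L (fun x i => ((-(visonSign L R x i) : ℝ) : ℂ))
    (fun x i => ((visonSign L R x i * Δ₀ * (if i = 0 then (1:ℝ) else -1) : ℝ) : ℂ)) μ

/-- The form of the vison premise that the weak-coupling limit CONSUMES: the pair cost is bounded
uniformly in the gap `Δ₀ ∈ (0, 1]` (the BdG gap `Δ₀ ≍ e^{-C/U²} → 0` as `U → 0⁺`), not only for
each fixed `Δ₀` as in `VisonPairCost`. -/
def VisonPairCostUniform : Prop :=
  ∀ μ : ℝ, μ ∈ Set.Ioo (-4 : ℝ) 4 → μ ≠ 0 → ∃ C : ℝ, ∀ Δ₀ : ℝ, Δ₀ ∈ Set.Ioc (0:ℝ) 1 →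
    ∀ (L : ℕ) [NeZero L], 4 ≤ L → ∀ R : ℕ, 2 * R ≤ L →
      |(visonBdG L μ Δ₀ R).groundEnergy - (visonBdG L μ Δ₀ 0).groundEnergy| ≤ C

/-- Its free-fermion anchor (`Δ₀ = 0`): two Aharonov–Bohm half-flux tubes at separation `R` in the
lattice Fermi sea cost a bounded energy, uniformly in `L` and `R`. The SIGN of this number as a
function of the filling (Lieb's π-flux affinity near half filling versus Landau diamagnetism at low
density) is the U-independent part of the vortex budget. -/
def VisonPairCostFree : Prop :=
  ∀ μ : ℝ, μ ∈ Set.Ioo (-4 : ℝ) 4 → ∃ C : ℝ,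
    ∀ (L : ℕ) [NeZero L], 4 ≤ L → ∀ R : ℕ, 2 * R ≤ L →
      |(visonBdG L μ 0 R).groundEnergy - (visonBdG L μ 0 0).groundEnergy| ≤ C

/-! ## Card C — zero-field plateau + Koma–Tasaki bridge -/

/-- Koma–Tasaki / Kaplan–Horsch–von der Linden bridge for the grand-canonical Hubbard torus:
plateau `d`-wave pair LRO `a > 0` of the TRACIAL ground-state functional of `hubbardTorusWith` at
`h = 0` along `L → ∞` forces `dWaveOrderParameter U μ ≥ √(a/2)` (hence `HasDWaveOrder U μ`).
Proof plan (provable now, M): pick an `N`-eigenstate ground vector `Φ` with `⟨Δ_d†Δ_d⟩ ≥ a L⁴`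
(block-diagonality of `Δ_d†Δ_d` in `N`); trial state `Ξ = (Φ + OΦ/‖OΦ‖)/√2`, `O = Δ_d + Δ_d†`;
`⟨Ξ,OΞ⟩ = ‖OΦ‖ ≥ √(2aL⁴ - CL²)`, `⟨Ξ,(H-μN)Ξ⟩ ≤ E₀ + ‖[O,[H,O]]‖/(4‖OΦ‖²) = E₀ + O(L⁻²)`;
variational principle for `dWaveSourceTorus`; conclude with
`le_dWaveOrderParameter_of_le_liminf_energyGain`. -/
def KTBridge : Prop :=
  ∀ U μ a : ℝ, 0 < a →
    (∀ᶠ L : ℕ in atTop, a * (((L + 1 : ℕ) : ℝ)) ^ 4 ≤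
      ((hubbardTorusWith 2 (L + 1) 1 U μ).groundStateFunctional
        ((pairField dWaveFormFactor (L + 1))ᴴ * pairField dWaveFormFactor (L + 1))).re) →
    Real.sqrt (a / 2) ≤ dWaveOrderParameter U μ

/-- The RE-AIMED conclusion of the crux: zero-field torus plateau order of the tracial
grand-canonical ground state at a density-matched `μ` (exactly the output shape of the engine
`PerturbedXYOrder`: torus, no field, Cesàro double sum), from which `NodalReduction`'s conclusion
follows by `KTBridge` (below). -/
def ZeroFieldTarget : Prop :=
  VisonPairCost → PerturbedXYOrder →
    ∃ δ ∈ Set.Ioo (0:ℝ) (1/2), ∃ U₀ : ℝ, 0 < U₀ ∧ ∀ U ∈ Set.Ioo (0:ℝ) U₀, ∃ μ : ℝ,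
      Filter.Tendsto (fun L : ℕ => ((hubbardTorusWith 2 (L + 1) 1 U μ).groundStateFunctional
        totalNumber).re / ((L + 1 : ℕ) : ℝ) ^ 2) Filter.atTop (nhds (1 - δ)) ∧
      ∃ a : ℝ, 0 < a ∧ ∀ᶠ L : ℕ in atTop, a * (((L + 1 : ℕ) : ℝ)) ^ 4 ≤
        ((hubbardTorusWith 2 (L + 1) 1 U μ).groundStateFunctional
          ((pairField dWaveFormFactor (L + 1))ᴴ * pairField dWaveFormFactor (L + 1))).re

/-- Composition (pure logic): the bridge turns the re-aimed target into the crux BY NAME. -/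
theorem nodalReduction_of_zeroField (hB : KTBridge) (hT : ZeroFieldTarget) : NodalReduction := by
  intro hV hE
  obtain ⟨δ, hδ, U₀, hU₀, hwin⟩ := hT hV hE
  refine ⟨δ, hδ, U₀, hU₀, fun U hU => ?_⟩
  obtain ⟨μ, hdens, a, ha, hplat⟩ := hwin U hU
  refine ⟨μ, hdens, ?_⟩
  have h : Real.sqrt (a / 2) ≤ dWaveOrderParameter U μ := hB U μ a ha hplat
  have hs : (0 : ℝ) < Real.sqrt (a / 2) := Real.sqrt_pos.2 (by linarith)
  show (0 : ℝ) < dWaveOrderParameter U μ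
  exact lt_of_lt_of_le hs h

end Summit.HubbardSuperconductivity.HubbardSuperconductivity.Cruxes.NodalReduction.Ideator2
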